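import Literature.NumberTheory.LFunctions.ZetaScaleTwistedPrimeSumTail
import HarnessLib

/-!
# Twisted logarithmic prime sums `∑ log p · p^{-σ-it}` over the Vinogradov–Korobov window,
# from scale-wise zero-freeness of `ζ` (Hildebrand–Tenenbaum, Lemma 6, prime form)

Topic `Literature/NumberTheory/LFunctions`.  Everything in this file is PROVED; there are no
definitions and no named facts.

Hildebrand–Tenenbaum, Trans. AMS 296 (1986), Lemma 6 (3.10): for `s = 1 − β + iτ`,
`∑_{n ≤ y} Λ(n) n^{-s} = y^{1-s}/(1-s) + O_ε(1 + y^{1-σ} exp(−(log y)^{ε/2}))` ("by the usual contour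
integration … using Vinogradov's zero-free region for `ζ(s)`"), the input of their Lemma 8 (ii).  Here
the corresponding statement over PRIMES and in the Vinogradov–Korobov WINDOW is derived, by Abel
summation with the weight `u^{-σ}`, from the tree's twisted prime number theorem for the principal
character at scale `X` (`ZetaScale.twisted_sum_estimate_one_of_scale`, itself from the hypothesis

  `hZ : ∀ η > 2/3, ∀ᶠ X, ∀ s, |Im s| ≤ 3X → 1 − (log X)^{-η} ≤ Re s → ζ₁ s ≠ 0`

alone):

* `ZetaScale.scaleZeroFree_of_riemannHypothesis` — `hZ` from the Riemann Hypothesis (trivially: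
  under RH `ζ(s) ≠ 0` for `Re s > 1/2`);
* `ZetaScale.norm_sum_primes_log_rpow_cpow_le_of_scale` — for `θ > 2/3` and all large `X`: for
  `1 ≤ |t| ≤ X`, `0 < σ < 1` and naturals `exp((log X)^θ)/2 ≤ n ≤ m ≤ X`,
  `‖∑_{n < p ≤ m} log p · p^{-σ} · p^{-it}‖ ≤ m^{1-σ} (2/|t| + (log X)^{-2} (4 + 2/(1 − σ)))`
  (main term `∫_n^m u^{-σ-it} du`, of norm `≤ 2 m^{1-σ}/|t|`);
* `ZetaScale.sum_primes_log_rpow_cos_le_of_scale` — its real part: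
  `∑_{n < p ≤ m} log p · p^{-σ} cos(t log p) ≤ m^{1-σ} (2/|t| + (log X)^{-2} (4 + 2/(1 − σ)))`.

The consumer is the long-range decay of the friable zeta ratio under RH
(`Literature/NumberTheory/Sieve/SmoothZetaDecayLongRangeScale.lean`).

## References

* A. Hildebrand, G. Tenenbaum, Trans. AMS 296 (1986) 265–290, Lemma 6 (3.10) and its Corollary
  [HildebrandTenenbaum1986].
* K. Matomäki, M. Radziwiłł, Ann. of Math. 183 (2016), Lemma 2 (proof) — the Abel summation template
  (`ZetaScale.norm_primeCharSum_le_one_of_scale`). [MatomakiRadziwillAnnals2016]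
-/

noncomputable section

open MeasureTheory Set intervalIntegral Complex Filter Topology

namespace Literature.NumberTheory.LFunctions

namespace ZetaScale

open Literature.NumberTheory.Sieve.Lichtman2020.PrimeCharSum TwistedVonMangoldt MRT2015DistLowerBound
open TwistedPrimeSumTail VKDirichlet

/-- **Scale-wise zero-freeness of `ζ₁` from the Riemann Hypothesis.**  Under RH, for every `η > 0`
(in particular `η > 2/3`) and all large `X`, `ζ₁(s) ≠ 0` whenever `Re s ≥ 1 − (log X)^{-η}`
(`> 1/2` for large `X`): a zero of `ζ₁ = (s−1)ζ` is a non-trivial zero of `ζ` (the trivial ones have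
negative real part), hence on `Re s = 1/2`. [folklore] -/
theorem scaleZeroFree_of_riemannHypothesis (hRH : RiemannHypothesis) :
    ∀ η : ℝ, 2 / 3 < η → ∀ᶠ X : ℝ in atTop, ∀ s : ℂ, |s.im| ≤ 3 * X →
      1 - Real.log X ^ (-η) ≤ s.re → riemannZeta₁ s ≠ 0 := by
  intro η hη
  have hη0 : 0 < η := by linarith
  filter_upwards [eventually_rpow_neg_lt hη0 (show (0 : ℝ) < 1 / 2 by norm_num)] with X hhalf
  intro s _ hre hzero
  have hs1 : s ≠ 1 := ne_one_of_riemannZeta₁_eq_zero hzero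
  have hζ : riemannZeta s = 0 := (riemannZeta₁_eq_zero_iff hs1).1 hzero
  have htriv : ¬ ∃ n : ℕ, s = -2 * (n + 1) := by
    rintro ⟨n, rfl⟩
    have h1 : ((-2 : ℂ) * (n + 1)).re = -2 * (n + 1) := by simp
    rw [h1] at hre
    have h2 : (0 : ℝ) ≤ n := Nat.cast_nonneg n
    linarith
  have h := hRH s hζ htriv hs1
  linarith

/-- For a prime `k`, `k^{-σ} · c(k) = (log k · k^{-σ}) · k^{-it}`, where `c(k) = χ₀(k) log k · k^{-it}`
is the prime coefficient of the trivial character mod `1`. [folklore] -/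
theorem rpow_mul_primeCoeff_one {k : ℕ} (hk : k.Prime) (σ t : ℝ) :
    (((k : ℝ) ^ (-σ) : ℝ) : ℂ) * primeCoeff (1 : DirichletCharacter ℂ 1) t k =
      ((Real.log k * (k : ℝ) ^ (-σ) : ℝ) : ℂ) * (k : ℂ) ^ (-((t : ℂ) * I)) := by
  simp only [primeCoeff, if_pos hk, dirichletCharacter_one_mod_one_apply, one_mul]
  push_cast
  ring

/-- The prime sum as an Abel sum: `∑_{n < p ≤ m} (log p · p^{-σ}) p^{-it} = ∑_{k ∈ (n, m]} k^{-σ} c(k)`.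
[folklore] -/
theorem sum_primes_log_rpow_cpow_eq (σ t : ℝ) (n m : ℕ) :
    ∑ p ∈ (Finset.Ioc n m).filter Nat.Prime,
        ((Real.log p * (p : ℝ) ^ (-σ) : ℝ) : ℂ) * (p : ℂ) ^ (-((t : ℂ) * I)) =
      ∑ k ∈ Finset.Ioc n m, (((k : ℝ) ^ (-σ) : ℝ) : ℂ) * primeCoeff (1 : DirichletCharacter ℂ 1) t k := by
  rw [Finset.sum_filter]
  refine Finset.sum_congr rfl fun k _ ↦ ?_
  by_cases hk : k.Prime
  · rw [if_pos hk, rpow_mul_primeCoeff_one hk]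
  · rw [if_neg hk, primeCoeff_of_not_prime _ t hk, mul_zero]

/-- The weight `u ↦ (u^{-σ} : ℂ)` has derivative `−σ u^{-σ-1}` at `u > 0`. [folklore] -/
theorem hasDerivAt_rpowWeightC {u : ℝ} (hu : 0 < u) (σ : ℝ) :
    HasDerivAt (fun u : ℝ ↦ (((u ^ (-σ) : ℝ)) : ℂ)) ((((-σ) * u ^ (-σ - 1) : ℝ)) : ℂ) u :=
  (Real.hasDerivAt_rpow_const (Or.inl hu.ne')).ofReal_comp

set_option maxHeartbeats 1600000 in
/-- **Twisted logarithmic prime sums over the Vinogradov–Korobov window** (Hildebrand–Tenenbaum's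
Lemma 6 over primes, scale-wise form).  Assume `hZ` and let `θ > 2/3`.  For all large `X`, all real
`t` with `1 ≤ |t| ≤ X`, all `0 < σ < 1` and all naturals `n ≤ m` with `exp((log X)^θ)/2 ≤ n`, `m ≤ X`:
`‖∑_{n < p ≤ m} log p · p^{-σ} · p^{-it}‖ ≤ m^{1-σ} (2/|t| + (log X)^{-2}(4 + 2/(1-σ)))`.
Proof: Abel summation with `f(u) = u^{-σ}` against `D(u) = ∑_{p ≤ u} log p · p^{-it} = u^{1-it}/(1-it) + O(u (log X)^{-2})`
(`ZetaScale.twisted_sum_estimate_one_of_scale` and `ψ − ϑ ≤ (log X)^{-2} u` on the window); the main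
term is `∫_n^m u^{-σ-it} du = [u^{1-σ-it}/(1-σ-it)]_n^m`, of norm `≤ 2m^{1-σ}/|t|`, and the error is
`≤ (log X)^{-2}(2m^{1-σ} + 2n^{1-σ} + 2σ∫_n^m u^{-σ} du)`.
[cite: HildebrandTenenbaum1986, Lemma 6 (3.10)] -/
theorem norm_sum_primes_log_rpow_cpow_le_of_scale
    (hZ : ∀ η : ℝ, 2 / 3 < η → ∀ᶠ X : ℝ in atTop, ∀ s : ℂ, |s.im| ≤ 3 * X →
      1 - Real.log X ^ (-η) ≤ s.re → riemannZeta₁ s ≠ 0)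
    {θ : ℝ} (hθ : 2 / 3 < θ) :
    ∀ᶠ X : ℝ in atTop, ∀ t : ℝ, 1 ≤ |t| → |t| ≤ X → ∀ σ : ℝ, 0 < σ → σ < 1 →
      ∀ n m : ℕ, Real.exp (Real.log X ^ θ) / 2 ≤ n → n ≤ m → (m : ℝ) ≤ X →
        ‖∑ p ∈ (Finset.Ioc n m).filter Nat.Prime,
            ((Real.log p * (p : ℝ) ^ (-σ) : ℝ) : ℂ) * (p : ℂ) ^ (-((t : ℂ) * I))‖ ≤
          (m : ℝ) ^ (1 - σ) * (2 / |t| + Real.log X ^ (-(2 : ℝ)) * (4 + 2 / (1 - σ))) := by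
  have hθ0 : 0 < θ := by linarith
  filter_upwards [twisted_sum_estimate_one_of_scale hZ one_pos hθ (K := 2) (by norm_num),
    Real.tendsto_log_atTop.eventually_ge_atTop (16 : ℝ),
    ((tendsto_rpow_atTop hθ0).comp Real.tendsto_log_atTop).eventually_ge_atTop (4 : ℝ),
    eventually_mul_log_rpow_le_exp 16 2 (show (0 : ℝ) < 1 / 4 by norm_num) hθ0,
    eventually_gt_atTop (0 : ℝ)] with X htw hℓ16 hℓθ hEψ hX0
  intro t ht1 htX σ hσ0 hσ1 n m hn hnm hmX
  set ℓ : ℝ := Real.log X with hℓdef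
  have hℓ0 : 0 < ℓ := by linarith
  have hℓθ' : (4 : ℝ) ≤ ℓ ^ θ := by simpa using hℓθ
  have hβ0 : 0 < 1 - σ := by linarith
  have ht0 : 0 < |t| := by linarith
  -- parameters
  set ε : ℝ := ℓ ^ (-(2 : ℝ)) with hεdef
  have hε0 : 0 < ε := Real.rpow_pos_of_pos hℓ0 _
  have hεψ : 16 * Real.exp (-(ℓ ^ θ / 4)) ≤ ε := by
    have hprod : ℓ ^ (2 : ℝ) * ε = 1 := by
      rw [hεdef, ← Real.rpow_add hℓ0, add_neg_cancel, Real.rpow_zero]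
    have h1 := mul_le_mul_of_nonneg_right hEψ (show 0 ≤ Real.exp (-(ℓ ^ θ / 4)) * ε by positivity)
    have h2 : 16 * ℓ ^ (2 : ℝ) * (Real.exp (-(ℓ ^ θ / 4)) * ε) =
        16 * Real.exp (-(ℓ ^ θ / 4)) * (ℓ ^ (2 : ℝ) * ε) := by ring
    have h3 : Real.exp (1 / 4 * ℓ ^ θ) * (Real.exp (-(ℓ ^ θ / 4)) * ε) = ε := by
      rw [← mul_assoc, ← Real.exp_add, show 1 / 4 * ℓ ^ θ + -(ℓ ^ θ / 4) = 0 by ring, Real.exp_zero,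
        one_mul]
    rw [h2, hprod, mul_one, h3] at h1
    exact h1
  -- `n`, `m`
  have he4 : (5 : ℝ) ≤ Real.exp 4 := by have := Real.add_one_le_exp (4 : ℝ); linarith
  have hexpP : Real.exp 4 ≤ Real.exp (ℓ ^ θ) := Real.exp_le_exp.2 hℓθ'
  have hn2 : (2 : ℝ) ≤ n := by linarith
  have hn0 : (0 : ℝ) < n := by linarith
  have hnmR : (n : ℝ) ≤ m := by exact_mod_cast hnm
  have hm0 : (0 : ℝ) < m := by linarith
  have hq1 : ((1 : ℕ) : ℝ) ≤ Real.log X ^ (1 : ℝ) := by rw [Real.rpow_one, Nat.cast_one]; linarith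
  set χ : DirichletCharacter ℂ 1 := 1 with hχdef
  -- the weight `f(u) = u^{-σ}` and its derivative
  set f : ℝ → ℂ := fun u ↦ (((u ^ (-σ) : ℝ)) : ℂ) with hfdef
  set w' : ℝ → ℂ := fun u ↦ ((((-σ) * u ^ (-σ - 1) : ℝ)) : ℂ) with hw'def
  have hfderiv : ∀ u : ℝ, 0 < u → HasDerivAt f (w' u) u := fun u hu ↦ hasDerivAt_rpowWeightC hu σ
  have hnorm_f : ∀ u : ℝ, 0 < u → ‖f u‖ = u ^ (-σ) := fun u hu ↦ by
    simp only [hfdef, Complex.norm_real, Real.norm_eq_abs, abs_of_pos (Real.rpow_pos_of_pos hu _)]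
  have hnorm_w' : ∀ u : ℝ, 0 < u → ‖w' u‖ = σ * u ^ (-σ - 1) := fun u hu ↦ by
    simp only [hw'def, Complex.norm_real, Real.norm_eq_abs, neg_mul, abs_neg,
      abs_of_pos (mul_pos hσ0 (Real.rpow_pos_of_pos hu _))]
  -- the main term `M(u) = δ u^{r+1}/(r+1)`, `r = -it`, and its derivative `M'(u) = δ u^r`
  set r : ℂ := -((t : ℂ) * I) with hrdef
  have hr1 : r + 1 = 1 - t * I := by rw [hrdef]; ring
  have hrne : r ≠ -1 := by
    intro h
    have := congrArg Complex.re h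
    simp [hrdef] at this
  set M : ℝ → ℂ := fun u => delta χ * ((u : ℂ) ^ (r + 1) / (r + 1)) with hMdef
  set M' : ℝ → ℂ := fun u => delta χ * (u : ℂ) ^ r with hM'def
  have hδ : delta χ = 1 := by simp [delta, hχdef]
  have hMderiv : ∀ u ∈ uIcc (n : ℝ) m, HasDerivAt M (M' u) u := by
    intro u hu
    rw [uIcc_of_le hnmR] at hu
    have hu0 : u ≠ 0 := by linarith [hu.1]
    exact (hasDerivAt_ofReal_cpow_const' hu0 hrne).const_mul (delta χ)
  have hMeq : ∀ u : ℝ, M u = delta χ * (u : ℂ) ^ (1 - t * I) / (1 - t * I) := by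
    intro u
    simp only [hMdef, hr1, mul_div_assoc]
  -- `‖D(u) − M(u)‖ ≤ 2εu` on `[n, m]`
  have hDM : ∀ u : ℝ, (n : ℝ) ≤ u → u ≤ m →
      ‖∑ k ∈ Finset.Icc 0 ⌊u⌋₊, primeCoeff χ t k - M u‖ ≤ 2 * ε * u := by
    intro u hu1 hu2
    have hulo : Real.exp (ℓ ^ θ) / 2 ≤ u := hn.trans hu1
    have huX : u ≤ X := hu2.trans hmX
    rw [hMeq]
    exact norm_sum_primeCoeff_sub_le χ t (htw 1 hq1 χ rfl t htX u hulo huX)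
      (psi_sub_theta_le_of_scale hℓθ' hεψ hulo)
  -- Abel summation
  have hf_diff : ∀ u ∈ Set.Icc (n : ℝ) m, DifferentiableAt ℝ f u :=
    fun u hu ↦ (hfderiv u (by linarith [hu.1])).differentiableAt
  have hderiv : ∀ u ∈ Set.Icc (n : ℝ) m, deriv f u = w' u :=
    fun u hu ↦ (hfderiv u (by linarith [hu.1])).deriv
  have hcontR : ContinuousOn (fun u : ℝ ↦ (-σ) * u ^ (-σ - 1)) (Set.Icc (n : ℝ) m) := by
    refine continuousOn_const.mul (ContinuousOn.rpow_const continuousOn_id fun u hu ↦ ?_)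
    exact Or.inl (by linarith [hu.1] : (0 : ℝ) < u).ne'
  have hcontC : ContinuousOn w' (Set.Icc (n : ℝ) m) := Complex.continuous_ofReal.comp_continuousOn hcontR
  have hf_int : IntegrableOn (deriv f) (Set.Icc (n : ℝ) m) :=
    (hcontC.integrableOn_Icc).congr_fun (fun u hu ↦ (hderiv u hu).symm) measurableSet_Icc
  have hAbel : ∑ k ∈ Finset.Ioc n m, f k * primeCoeff χ t k =
      f m * (∑ k ∈ Finset.Icc 0 m, primeCoeff χ t k) -
        f n * (∑ k ∈ Finset.Icc 0 n, primeCoeff χ t k) -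
        ∫ u in Set.Ioc (n : ℝ) m, deriv f u * ∑ k ∈ Finset.Icc 0 ⌊u⌋₊, primeCoeff χ t k :=
    sum_mul_eq_sub_sub_integral_mul' (primeCoeff χ t) hnm hf_diff hf_int
  -- the Abel integral as an interval integral of `w' · D`
  set D : ℝ → ℂ := fun u ↦ ∑ k ∈ Finset.Icc 0 ⌊u⌋₊, primeCoeff χ t k with hDdef
  have hIoc : ∫ u in Set.Ioc (n : ℝ) m, deriv f u * ∑ k ∈ Finset.Icc 0 ⌊u⌋₊, primeCoeff χ t k =
      ∫ u in (n : ℝ)..m, w' u * D u := by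
    rw [intervalIntegral.integral_of_le hnmR]
    refine setIntegral_congr_fun measurableSet_Ioc fun u hu => ?_
    simp only [hDdef]
    rw [hderiv u ⟨hu.1.le, hu.2⟩]
  -- integrability of `w' · D` and `w' · M`, `M'`
  have hwD_int : IntervalIntegrable (fun u => w' u * D u) volume n m := by
    rw [intervalIntegrable_iff_integrableOn_Icc_of_le hnmR]
    exact integrableOn_mul_sum_Icc (primeCoeff χ t) (Nat.cast_nonneg n) hcontC.integrableOn_Icc
  have hMcont : ContinuousOn M (uIcc (n : ℝ) m) :=
    continuousOn_const.mul ((continuousOn_ofReal_cpow_const hn0 hnmR (r + 1)).div_const (r + 1))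
  have hM'cont : ContinuousOn M' (uIcc (n : ℝ) m) :=
    continuousOn_const.mul (continuousOn_ofReal_cpow_const hn0 hnmR r)
  have hw'cont : ContinuousOn w' (uIcc (n : ℝ) m) := by rw [uIcc_of_le hnmR]; exact hcontC
  have hwM_int : IntervalIntegrable (fun u => w' u * M u) volume n m :=
    (hw'cont.mul hMcont).intervalIntegrable
  have hw'_int : IntervalIntegrable w' volume n m := hw'cont.intervalIntegrable
  have hM'_int : IntervalIntegrable M' volume n m := hM'cont.intervalIntegrable
  -- integration by parts for the main term
  have hwderiv : ∀ u ∈ uIcc (n : ℝ) m, HasDerivAt f (w' u) u := by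
    intro u hu
    rw [uIcc_of_le hnmR] at hu
    exact hfderiv u (by linarith [hu.1])
  have hIBP : ∫ u in (n : ℝ)..m, f u * M' u = f m * M m - f n * M n - ∫ u in (n : ℝ)..m, w' u * M u :=
    intervalIntegral.integral_mul_deriv_eq_deriv_mul hwderiv hMderiv hw'_int hM'_int
  -- the decomposition `S = Main + Err`
  set Main : ℂ := ∫ u in (n : ℝ)..m, f u * M' u with hMain
  set Err : ℂ := f m * (D m - M m) - f n * (D n - M n) - ∫ u in (n : ℝ)..m, w' u * (D u - M u) with hErr
  have hsub_int : ∫ u in (n : ℝ)..m, w' u * (D u - M u) =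
      (∫ u in (n : ℝ)..m, w' u * D u) - ∫ u in (n : ℝ)..m, w' u * M u := by
    rw [← intervalIntegral.integral_sub hwD_int hwM_int]
    refine intervalIntegral.integral_congr fun u _ => ?_
    simp only [mul_sub]
  have hDm : D m = ∑ k ∈ Finset.Icc 0 m, primeCoeff χ t k := by simp only [hDdef, Nat.floor_natCast]
  have hDn : D n = ∑ k ∈ Finset.Icc 0 n, primeCoeff χ t k := by simp only [hDdef, Nat.floor_natCast]
  have hdecomp : ∑ k ∈ Finset.Ioc n m, f k * primeCoeff χ t k = Main + Err := by
    rw [hAbel, hIoc, hIBP, hErr, hsub_int, hDm, hDn]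
    ring
  -- size of the error
  have hpow_m : (m : ℝ) ^ (-σ) * m = (m : ℝ) ^ (1 - σ) := by
    rw [Real.rpow_sub hm0, Real.rpow_one, Real.rpow_neg hm0.le, div_eq_mul_inv, mul_comm]
  have hpow_n : (n : ℝ) ^ (-σ) * n = (n : ℝ) ^ (1 - σ) := by
    rw [Real.rpow_sub hn0, Real.rpow_one, Real.rpow_neg hn0.le, div_eq_mul_inv, mul_comm]
  have hnm_pow : (n : ℝ) ^ (1 - σ) ≤ (m : ℝ) ^ (1 - σ) := Real.rpow_le_rpow hn0.le hnmR hβ0.le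
  have hmpow0 : 0 < (m : ℝ) ^ (1 - σ) := Real.rpow_pos_of_pos hm0 _
  have hDMm : ‖D m - M m‖ ≤ 2 * ε * m := by
    rw [hDm]; have := hDM m hnmR le_rfl; rwa [Nat.floor_natCast] at this
  have hDMn : ‖D n - M n‖ ≤ 2 * ε * n := by
    rw [hDn]; have := hDM n le_rfl hnmR; rwa [Nat.floor_natCast] at this
  have hwm : ‖f m * (D m - M m)‖ ≤ 2 * ε * (m : ℝ) ^ (1 - σ) := by
    rw [norm_mul, hnorm_f m hm0]
    calc (m : ℝ) ^ (-σ) * ‖D m - M m‖ ≤ (m : ℝ) ^ (-σ) * (2 * ε * m) :=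
          mul_le_mul_of_nonneg_left hDMm (Real.rpow_nonneg hm0.le _)
      _ = 2 * ε * ((m : ℝ) ^ (-σ) * m) := by ring
      _ = 2 * ε * (m : ℝ) ^ (1 - σ) := by rw [hpow_m]
  have hwn : ‖f n * (D n - M n)‖ ≤ 2 * ε * (m : ℝ) ^ (1 - σ) := by
    rw [norm_mul, hnorm_f n hn0]
    calc (n : ℝ) ^ (-σ) * ‖D n - M n‖ ≤ (n : ℝ) ^ (-σ) * (2 * ε * n) :=
          mul_le_mul_of_nonneg_left hDMn (Real.rpow_nonneg hn0.le _)
      _ = 2 * ε * ((n : ℝ) ^ (-σ) * n) := by ring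
      _ = 2 * ε * (n : ℝ) ^ (1 - σ) := by rw [hpow_n]
      _ ≤ 2 * ε * (m : ℝ) ^ (1 - σ) := by gcongr
  set g : ℝ → ℝ := fun u ↦ 2 * ε * σ * u ^ (-σ) with hgdef
  have hgcont : ContinuousOn g (Set.Icc (n : ℝ) m) := by
    refine continuousOn_const.mul (ContinuousOn.rpow_const continuousOn_id fun u hu ↦ ?_)
    exact Or.inl (by linarith [hu.1] : (0 : ℝ) < u).ne'
  have hgi : IntervalIntegrable g volume n m := by
    rw [intervalIntegrable_iff_integrableOn_Icc_of_le hnmR]; exact hgcont.integrableOn_Icc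
  have hbound : ∀ᵐ u : ℝ ∂volume, u ∈ Set.Ioc (n : ℝ) m → ‖w' u * (D u - M u)‖ ≤ g u := by
    refine ae_of_all _ fun u hu ↦ ?_
    have hu1 : (n : ℝ) < u := hu.1
    have hu2 : u ≤ m := hu.2
    have hu0 : 0 < u := by linarith
    rw [norm_mul, hnorm_w' u hu0]
    have h2 := hDM u hu1.le hu2
    have hsplit : u ^ (-σ - 1) * u = u ^ (-σ) := by
      rw [Real.rpow_sub hu0, Real.rpow_neg hu0.le, Real.rpow_one]; field_simp
    calc σ * u ^ (-σ - 1) * ‖D u - M u‖ ≤ σ * u ^ (-σ - 1) * (2 * ε * u) :=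
          mul_le_mul_of_nonneg_left h2 (by positivity)
      _ = 2 * ε * σ * (u ^ (-σ - 1) * u) := by ring
      _ = g u := by rw [hsplit]
  have hint : ‖∫ u in (n : ℝ)..m, w' u * (D u - M u)‖ ≤ 2 * ε * (m : ℝ) ^ (1 - σ) / (1 - σ) := by
    refine (intervalIntegral.norm_integral_le_of_norm_le hnmR hbound hgi).trans ?_
    rw [hgdef, intervalIntegral.integral_const_mul,
      integral_rpow (Or.inl (by linarith : (-1 : ℝ) < -σ))]
    rw [show -σ + 1 = 1 - σ by ring]
    have hnpow0 : 0 ≤ (n : ℝ) ^ (1 - σ) := Real.rpow_nonneg hn0.le _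
    have h1 : ((m : ℝ) ^ (1 - σ) - (n : ℝ) ^ (1 - σ)) / (1 - σ) ≤ (m : ℝ) ^ (1 - σ) / (1 - σ) :=
      div_le_div_of_nonneg_right (by linarith) hβ0.le
    calc 2 * ε * σ * (((m : ℝ) ^ (1 - σ) - (n : ℝ) ^ (1 - σ)) / (1 - σ))
        ≤ 2 * ε * σ * ((m : ℝ) ^ (1 - σ) / (1 - σ)) := mul_le_mul_of_nonneg_left h1 (by positivity)
      _ ≤ 2 * ε * 1 * ((m : ℝ) ^ (1 - σ) / (1 - σ)) := by gcongr
      _ = 2 * ε * (m : ℝ) ^ (1 - σ) / (1 - σ) := by ring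
  have hErr_le : ‖Err‖ ≤ ε * (m : ℝ) ^ (1 - σ) * (4 + 2 / (1 - σ)) := by
    calc ‖Err‖ ≤ ‖f m * (D m - M m) - f n * (D n - M n)‖ + ‖∫ u in (n : ℝ)..m, w' u * (D u - M u)‖ :=
          norm_sub_le _ _
      _ ≤ (‖f m * (D m - M m)‖ + ‖f n * (D n - M n)‖) + ‖∫ u in (n : ℝ)..m, w' u * (D u - M u)‖ := by
          gcongr; exact norm_sub_le _ _
      _ ≤ (2 * ε * (m : ℝ) ^ (1 - σ) + 2 * ε * (m : ℝ) ^ (1 - σ)) +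
            2 * ε * (m : ℝ) ^ (1 - σ) / (1 - σ) := add_le_add (add_le_add hwm hwn) hint
      _ = ε * (m : ℝ) ^ (1 - σ) * (4 + 2 / (1 - σ)) := by field_simp; ring
  -- the main term `∫_n^m u^{-σ-it} du`
  have hMain_le : ‖Main‖ ≤ 2 * (m : ℝ) ^ (1 - σ) / |t| := by
    set w : ℂ := ((-σ : ℝ) : ℂ) + r with hwdef
    have hwre : w.re = -σ := by simp [hwdef, hrdef]
    have hw1 : (w + 1).re = 1 - σ := by rw [Complex.add_re, hwre, Complex.one_re]; ring
    have hw1im : (w + 1).im = -t := by simp [hwdef, hrdef]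
    have e : Main = ∫ u in (n : ℝ)..m, (u : ℂ) ^ w := by
      simp only [hMain]
      refine intervalIntegral.integral_congr fun u hu => ?_
      rw [uIcc_of_le hnmR] at hu
      have hu0 : 0 < u := by linarith [hu.1]
      simp only [hfdef, hM'def, hδ, one_mul]
      rw [Complex.ofReal_cpow hu0.le, hwdef, Complex.cpow_add _ _ (Complex.ofReal_ne_zero.2 hu0.ne')]
    rw [e, integral_cpow (Or.inl (by rw [hwre]; linarith))]
    have hnw : ‖w + 1‖ ≥ |t| := by
      have := Complex.abs_im_le_norm (w + 1)
      rwa [hw1im, abs_neg] at this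
    have hnw0 : 0 < ‖w + 1‖ := lt_of_lt_of_le ht0 hnw
    have hmw : ‖((m : ℝ) : ℂ) ^ (w + 1)‖ = (m : ℝ) ^ (1 - σ) := by
      rw [Complex.norm_cpow_eq_rpow_re_of_pos hm0, hw1]
    have hnw' : ‖((n : ℝ) : ℂ) ^ (w + 1)‖ = (n : ℝ) ^ (1 - σ) := by
      rw [Complex.norm_cpow_eq_rpow_re_of_pos hn0, hw1]
    rw [norm_div]
    calc ‖((m : ℝ) : ℂ) ^ (w + 1) - ((n : ℝ) : ℂ) ^ (w + 1)‖ / ‖w + 1‖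
        ≤ (‖((m : ℝ) : ℂ) ^ (w + 1)‖ + ‖((n : ℝ) : ℂ) ^ (w + 1)‖) / ‖w + 1‖ :=
          div_le_div_of_nonneg_right (norm_sub_le _ _) hnw0.le
      _ = ((m : ℝ) ^ (1 - σ) + (n : ℝ) ^ (1 - σ)) / ‖w + 1‖ := by rw [hmw, hnw']
      _ ≤ ((m : ℝ) ^ (1 - σ) + (m : ℝ) ^ (1 - σ)) / ‖w + 1‖ := by gcongr
      _ ≤ ((m : ℝ) ^ (1 - σ) + (m : ℝ) ^ (1 - σ)) / |t| :=
          div_le_div_of_nonneg_left (by positivity) ht0 hnw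
      _ = 2 * (m : ℝ) ^ (1 - σ) / |t| := by ring
  -- conclusion
  rw [sum_primes_log_rpow_cpow_eq, hdecomp]
  calc ‖Main + Err‖ ≤ ‖Main‖ + ‖Err‖ := norm_add_le _ _
    _ ≤ 2 * (m : ℝ) ^ (1 - σ) / |t| + ε * (m : ℝ) ^ (1 - σ) * (4 + 2 / (1 - σ)) :=
        add_le_add hMain_le hErr_le
    _ = (m : ℝ) ^ (1 - σ) * (2 / |t| + ε * (4 + 2 / (1 - σ))) := by ring

/-- The real part of a term: `Re((log p · p^{-σ}) p^{-it}) = log p · p^{-σ} cos(t log p)` (`p > 0`).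
[folklore] -/
theorem re_log_rpow_mul_cpow {p : ℕ} (hp : 0 < p) (σ t : ℝ) :
    (((Real.log p * (p : ℝ) ^ (-σ) : ℝ) : ℂ) * (p : ℂ) ^ (-((t : ℂ) * I))).re =
      Real.log p * (p : ℝ) ^ (-σ) * Real.cos (t * Real.log p) := by
  have hp0 : (0 : ℝ) < p := by exact_mod_cast hp
  have e : -((t : ℂ) * I) = ((-t : ℝ) : ℂ) * I := by push_cast; ring
  rw [Complex.re_ofReal_mul, e, show ((p : ℕ) : ℂ) = ((p : ℝ) : ℂ) by norm_cast,
    re_ofReal_cpow_mul_I hp0, neg_mul, Real.cos_neg]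

/-- **Real-part form.**  Under `hZ`, `θ > 2/3`: for all large `X`, `1 ≤ |t| ≤ X`, `0 < σ < 1`,
naturals `exp((log X)^θ)/2 ≤ n ≤ m ≤ X`:
`∑_{n < p ≤ m} log p · p^{-σ} cos(t log p) ≤ m^{1-σ} (2/|t| + (log X)^{-2}(4 + 2/(1-σ)))`
— Hildebrand–Tenenbaum's Corollary to Lemma 6 ("take the real part"), window form.
[cite: HildebrandTenenbaum1986, Lemma 6, Corollary] -/
theorem sum_primes_log_rpow_cos_le_of_scale
    (hZ : ∀ η : ℝ, 2 / 3 < η → ∀ᶠ X : ℝ in atTop, ∀ s : ℂ, |s.im| ≤ 3 * X →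
      1 - Real.log X ^ (-η) ≤ s.re → riemannZeta₁ s ≠ 0)
    {θ : ℝ} (hθ : 2 / 3 < θ) :
    ∀ᶠ X : ℝ in atTop, ∀ t : ℝ, 1 ≤ |t| → |t| ≤ X → ∀ σ : ℝ, 0 < σ → σ < 1 →
      ∀ n m : ℕ, Real.exp (Real.log X ^ θ) / 2 ≤ n → n ≤ m → (m : ℝ) ≤ X →
        ∑ p ∈ (Finset.Ioc n m).filter Nat.Prime,
            Real.log p * (p : ℝ) ^ (-σ) * Real.cos (t * Real.log p) ≤
          (m : ℝ) ^ (1 - σ) * (2 / |t| + Real.log X ^ (-(2 : ℝ)) * (4 + 2 / (1 - σ))) := by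
  filter_upwards [norm_sum_primes_log_rpow_cpow_le_of_scale hZ hθ] with X hX
  intro t ht1 htX σ hσ0 hσ1 n m hn hnm hmX
  have h := hX t ht1 htX σ hσ0 hσ1 n m hn hnm hmX
  have hre : (∑ p ∈ (Finset.Ioc n m).filter Nat.Prime,
      ((Real.log p * (p : ℝ) ^ (-σ) : ℝ) : ℂ) * (p : ℂ) ^ (-((t : ℂ) * I))).re =
      ∑ p ∈ (Finset.Ioc n m).filter Nat.Prime,
        Real.log p * (p : ℝ) ^ (-σ) * Real.cos (t * Real.log p) := by
    rw [Complex.re_sum]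
    refine Finset.sum_congr rfl fun p hp => ?_
    exact re_log_rpow_mul_cpow (Finset.mem_filter.1 hp).2.pos σ t
  rw [← hre]
  exact (Complex.re_le_norm _).trans h

end ZetaScale

end Literature.NumberTheory.LFunctions

end
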